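import Summits.PneNP.PneNP.Theorems.SupportRectangleBlockLiftUDISJ
import Summits.PneNP.PneNP.Theorems.SmallBlockRothvossBallGridFormulation
import Literature.Combinatorics.Optimization.SDPFormulationMatchingSlack
import HarnessLib

/-!
# Block-diagonal SDP formulations of Boolean quadratic optimisation (correlation polytope), cell pnp-psdrank, eng g5

Formulation-level reading of `SupportRectangleBlockLift.udisj_blockPsd` in the tree's audited SDP-formulation
vocabulary (`Literature.Combinatorics.Optimization.SDPFormulation`, Braun et al. Def. 2.2), in parallel to the
matching file `SmallBlockRothvossBallGridFormulation`:

* `corProblem n` — the **Boolean quadratic problem** `BQP_n` (linear optimisation over the correlation polytope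
  `CORR_n = conv{x xᵀ : x ∈ {0,1}ⁿ}`): feasible solutions the subsets `x ⊆ Fin n`, objectives the matrices `c`,
  value `Σ_{i,j ∈ x} c_{ij}`, exact guarantees `C̃(c) = S̃(c) = max_x Σ_{i,j∈x} c_{ij}`
  [cite: BraunEtAl2016, Def. 2.1–2.2] [cite: FawziParrilo2013, §1.1 (COR(n))];
* `udisj_blockPsd_nonempty` — the UDISJ block bound with the factorization given only on the rows `a ≠ ∅`
  (the row `a = ∅` of the BQP slack matrix is identically `0`, not `1`);
* `corSDP_blockDiagonal` — **every exact SDP formulation of `BQP_n` (any size `d`) whose solution matrices `X^x`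
  are block diagonal for a block assignment `blk : Fin d → Fin m` with blocks of size `≤ b` (`b ≥ 1`, `n ≥ 2`) has
  `(3/2)^{n/(b+1)} ≤ m · 14400 b⁵ n⁶`**: by the factorization theorem for SDP formulations (exact case,
  `SDPFormulation.exists_posSemidef_slack_of_attained`) the slack of the objective `c_a` (`2Σ_{i∈a} x_i − (Σ_{i∈a} x_i)²`,
  maximum `1` for `a ≠ ∅`) at `x` is `(1 − |a ∩ x|)² = tr(U_a X^x)`; the diagonal blocks of the psd `U_a` are psd;
  extend by zero to size `b` (`SmallBlockRothvossBallGrid.trace_mul_blockDiagonal_split` etc.).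

So: a block-diagonal semidefinite extended formulation of the cut / correlation polytope with polynomially many blocks
has a block of dimension `Ω(n / log n)` (Fawzi–Parrilo: exponential only for blocks of size `O(1)`, base
`(1 − 3^{−b})^{−1/b}` [cite: FawziParrilo2013, Thm. 1]).
WHAT THIS IS NOT: not a bound for general (single-block) SDP formulations (`UDISJ(n)` has psd rank `≤ n + 1`; the
general bound is Lee–Raghavendra–Steurer's `2^{Ω(n^{2/13})}`); exact formulations only; nothing P ≠ NP-relevant.
-/

set_option linter.dupNamespace false -- `Summit.PneNP.PneNP.…`: summit = sub-problem (D-0017)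

noncomputable section

open scoped Classical MatrixOrder

open Finset Real Matrix Literature.Barriers.PneNP Literature.Combinatorics.Optimization
  Summit.PneNP.PneNP.Theorems.SmallBlockRothvossBallGrid

namespace Summit.PneNP.PneNP.Theorems.SupportRectangleBlockLift

variable {n : ℕ}

/-! ### The UDISJ bound from the rows `a ≠ ∅` only -/

/-- `Σ_c kwWeight n ∅ c = 2^n / 3^n` (every `c` is disjoint from `∅`). -/
theorem sum_kwWeight_empty : ∑ c, kwWeight n ∅ c = (2 : ℝ) ^ n * ((3 : ℝ) ^ n)⁻¹ := by
  unfold kwWeight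
  simp only [disjoint_empty_left, if_true, sum_const, card_univ, Fintype.card_finset, Fintype.card_fin,
    nsmul_eq_mul]
  push_cast
  ring

/-- `Σ_{a ≠ ∅} Σ_c kwWeight n a c = 1 − 2^n/3^n`. -/
theorem sum_kwWeight_nonempty :
    ∑ a : {a : Finset (Fin n) // a.Nonempty}, ∑ c, kwWeight n a.1 c = 1 - (2 : ℝ) ^ n * ((3 : ℝ) ^ n)⁻¹ := by
  have h1 : ∑ a ∈ (univ : Finset (Finset (Fin n))).filter (fun a => a.Nonempty), ∑ c, kwWeight n a c =
      ∑ a : {a : Finset (Fin n) // a.Nonempty}, ∑ c, kwWeight n a.1 c :=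
    sum_subtype _ (fun a => by simp) (fun a => ∑ c, kwWeight n a c)
  rw [← h1, ← sum_kwWeight (n := n), ← sum_kwWeight_empty (n := n)]
  have h2 : (univ : Finset (Finset (Fin n))).filter (fun a => a.Nonempty) = univ.erase ∅ := by
    ext a
    simp [nonempty_iff_ne_empty]
  rw [h2, sum_erase_eq_sub (mem_univ _)]

/-- **Block psd factorizations of `UDISJ(n)` from its nonempty rows.** For `n ≥ 2`, `b ≥ 1`: if
`(1 − |a ∩ c|)² = Σ_{i<m} tr(A_a^i B_c^i)` with psd `b × b` blocks for all NONEMPTY `a` and all `c`, then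
`(3/2)^{n/(b+1)} ≤ m · 14400 b⁵ n⁶`. (Datum: `kwWeight` rescaled by `3^n/(3^n − 2^n)` on the rows `a ≠ ∅`;
support rectangles still have `≤ 2^n` disjoint pairs by Kaibel–Weltge, so `θ₀ = 2^n/(3^n − 2^n)` and
`2/θ₀ = 2(1.5^n − 1) ≥ 1.5^n`.) [cite: KaibelWeltge2014, Thm. 1] [cite: FawziParrilo2013, Thm. 1] -/
theorem udisj_blockPsd_nonempty {b m : ℕ} (hn : 2 ≤ n) (hb : 1 ≤ b)
    (A : {a : Finset (Fin n) // a.Nonempty} → Fin m → Matrix (Fin b) (Fin b) ℝ)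
    (B : Finset (Fin n) → Fin m → Matrix (Fin b) (Fin b) ℝ)
    (hA : ∀ a i, (A a i).PosSemidef) (hB : ∀ c i, (B c i).PosSemidef)
    (hfac : ∀ a c, udisj n a.1 c = ∑ i, (A a i * B c i).trace) :
    (3 / 2 : ℝ) ^ ((n : ℝ) / (b + 1)) ≤ m * (14400 * (b : ℝ) ^ 5 * (n : ℝ) ^ 6) := by
  have hn1 : 1 ≤ n := le_trans one_le_two hn
  have hn2 : (2 : ℝ) ≤ n := by exact_mod_cast hn
  have hΔ2 : (2 : ℝ) ≤ (n : ℝ) ^ 2 := by nlinarith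
  -- `2^n < 3^n`, `(3/2)^n ≥ 2`
  have h23 : (2 : ℝ) ^ n < (3 : ℝ) ^ n := pow_lt_pow_left₀ (by norm_num) (by norm_num) (by omega)
  have h3pos : (0 : ℝ) < (3 : ℝ) ^ n := by positivity
  have h2pos : (0 : ℝ) < (2 : ℝ) ^ n := by positivity
  have hgap : (0 : ℝ) < (3 : ℝ) ^ n - (2 : ℝ) ^ n := by linarith
  set κ : ℝ := (3 : ℝ) ^ n * ((3 : ℝ) ^ n - (2 : ℝ) ^ n)⁻¹ with hκ
  have hκ0 : 0 ≤ κ := by rw [hκ]; positivity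
  -- the rescaled Kaibel–Weltge datum on the nonempty rows
  set W : {a : Finset (Fin n) // a.Nonempty} → Finset (Fin n) → ℝ := fun a c => κ * kwWeight n a.1 c with hW
  have hW0 : ∀ a c, 0 ≤ W a c := fun a c => mul_nonneg hκ0 (kwWeight_nonneg a.1 c)
  have hWsum : ∑ a, ∑ c, W a c = 1 := by
    have h1 : ∑ a, ∑ c, W a c = κ * ∑ a : {a : Finset (Fin n) // a.Nonempty}, ∑ c, kwWeight n a.1 c := by
      rw [mul_sum]
      exact sum_congr rfl fun a _ => by rw [mul_sum]
    rw [h1, sum_kwWeight_nonempty, hκ]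
    field_simp
  have hWS : ∑ a, ∑ c, W a c * udisj n a.1 c = 1 := by
    have h : ∀ (a : {a : Finset (Fin n) // a.Nonempty}) c, W a c * udisj n a.1 c = W a c := by
      intro a c
      simp only [hW]
      unfold kwWeight
      split_ifs with hd
      · rw [udisj_of_disjoint hd, mul_one]
      · rw [mul_zero, zero_mul]
    simp_rw [h]
    exact hWsum
  have hθ0 : (0 : ℝ) < (2 : ℝ) ^ n * ((3 : ℝ) ^ n - (2 : ℝ) ^ n)⁻¹ := by positivity
  have hrect : ∀ (X : Finset {a : Finset (Fin n) // a.Nonempty}) (Y : Finset (Finset (Fin n))),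
      (∀ a ∈ X, ∀ c ∈ Y, udisj n a.1 c ≠ 0) →
        ∑ a ∈ X, ∑ c ∈ Y, W a c ≤ (2 : ℝ) ^ n * ((3 : ℝ) ^ n - (2 : ℝ) ^ n)⁻¹ := by
    intro X Y hXY
    let emb : {a : Finset (Fin n) // a.Nonempty} ↪ Finset (Fin n) := ⟨Subtype.val, Subtype.val_injective⟩
    have h1 : ∑ a ∈ X, ∑ c ∈ Y, W a c = κ * ∑ a ∈ X.map emb, ∑ c ∈ Y, kwWeight n a c := by
      rw [sum_map, mul_sum]
      exact sum_congr rfl fun a _ => by rw [mul_sum]; rfl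
    have h2 : ∀ a ∈ X.map emb, ∀ c ∈ Y, udisj n a c ≠ 0 := by
      intro a ha c hc
      obtain ⟨a', ha', rfl⟩ := mem_map.1 ha
      exact hXY a' ha' c hc
    have h3 := kwWeight_rect (X.map emb) Y h2
    rw [h1]
    calc κ * ∑ a ∈ X.map emb, ∑ c ∈ Y, kwWeight n a c ≤ κ * ((2 : ℝ) ^ n * ((3 : ℝ) ^ n)⁻¹) :=
          mul_le_mul_of_nonneg_left h3 hκ0
      _ = (2 : ℝ) ^ n * ((3 : ℝ) ^ n - (2 : ℝ) ^ n)⁻¹ := by rw [hκ]; field_simp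
  have key := blockBound_supp (fun (a : {a : Finset (Fin n) // a.Nonempty}) c => udisj n a.1 c) W W hΔ2 hθ0
    (fun a c => udisj_le_sq hn1 a.1 c) hW0 (fun a c => le_rfl) hWsum.le hWS hrect hb A B hA hB hfac
  have hpow : ((n : ℝ) ^ 2) ^ 3 = (n : ℝ) ^ 6 := by ring
  rw [hpow] at key
  refine le_trans ?_ key
  -- `(3/2)^{n/(b+1)} ≤ (2 (3^n - 2^n)/2^n)^{1/(b+1)}`, since `(3/2)^n ≥ 2`
  have h32 : (2 : ℝ) / ((2 : ℝ) ^ n * ((3 : ℝ) ^ n - (2 : ℝ) ^ n)⁻¹) = 2 * (3 / 2 : ℝ) ^ n - 2 := by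
    rw [div_pow]; field_simp
  rw [h32]
  have h1 : (3 / 2 : ℝ) ^ ((n : ℝ) / (b + 1)) = ((3 / 2 : ℝ) ^ n) ^ ((1 : ℝ) / (b + 1)) := by
    rw [← Real.rpow_natCast, ← Real.rpow_mul (by norm_num)]
    congr 1
    field_simp
  rw [h1]
  refine Real.rpow_le_rpow (by positivity) ?_ (by positivity)
  have h2 : (2 : ℝ) ≤ (3 / 2 : ℝ) ^ n := by
    calc (2 : ℝ) ≤ (3 / 2 : ℝ) ^ 2 := by norm_num
      _ ≤ (3 / 2 : ℝ) ^ n := pow_le_pow_right₀ (by norm_num) hn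
  linarith

/-! ### The Boolean quadratic problem `BQP_n` in Braun et al.'s framework -/

/-- Value of the quadratic objective `c` at the `0/1` point `x ⊆ Fin n`: `⟨c, 1_x 1_xᵀ⟩ = Σ_{i,j ∈ x} c_{ij}`.
[cite: BraunEtAl2016, Def. 2.1] [cite: FawziParrilo2013, §1.1] -/
def corVal (c : Matrix (Fin n) (Fin n) ℝ) (x : Finset (Fin n)) : ℝ := ∑ i ∈ x, ∑ j ∈ x, c i j

/-- The maximum of the quadratic objective `c` over `{0,1}ⁿ` (a finite, nonempty set of values).
[cite: BraunEtAl2016, Def. 2.1] -/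
def corMax (c : Matrix (Fin n) (Fin n) ℝ) : ℝ :=
  (univ : Finset (Finset (Fin n))).sup' ⟨∅, mem_univ _⟩ (corVal c)

/-- **The Boolean quadratic problem `BQP_n`** (linear optimisation over the correlation polytope `CORR_n`) as a
maximisation problem with EXACT guarantees `C̃(c) = S̃(c) = max_x ⟨c, 1_x 1_xᵀ⟩`.
[cite: BraunEtAl2016, Def. 2.1–2.2] [cite: FawziParrilo2013, §1.1] -/
def corProblem (n : ℕ) : MaxProblem (Finset (Fin n)) (Matrix (Fin n) (Fin n) ℝ) where
  val c x := corVal c x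
  C c := corMax c
  S c := corMax c

/-- Every objective of `BQP_n` is sound (`val ≤ max`). -/
theorem corProblem_sound (c : Matrix (Fin n) (Fin n) ℝ) : (corProblem n).Sound c :=
  fun x => le_sup' (corVal c) (mem_univ x)

/-- Every guarantee of `BQP_n` is attained. -/
theorem corProblem_attained (c : Matrix (Fin n) (Fin n) ℝ) :
    ∃ x₀, (corProblem n).val c x₀ = (corProblem n).C c := by
  obtain ⟨x₀, _, hx₀⟩ := exists_mem_eq_sup' (⟨∅, mem_univ _⟩ : (univ : Finset (Finset (Fin n))).Nonempty)
    (corVal c)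
  exact ⟨x₀, hx₀.symm⟩

/-- The value of the row objective `c_a` at `x`: `1 − (1 − |a ∩ x|)²`. -/
theorem corVal_corRowMat (a x : Finset (Fin n)) : corVal (corRowMat a) x = 1 - udisj n a x := by
  rw [← corRow_slack_eq_udisj a x, sub_sub_cancel]
  unfold corVal indVec
  rw [← sum_subset (subset_univ x) fun i _ hi => by simp [hi]]
  refine sum_congr rfl fun i hi => ?_
  rw [← sum_subset (subset_univ x) fun j _ hj => by simp [hj]]
  refine sum_congr rfl fun j hj => ?_
  simp [hi, hj]

/-- For `a ≠ ∅` the maximum of `c_a` over `{0,1}ⁿ` is `1` (attained at any singleton `{i} ⊆ a`). -/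
theorem corMax_corRowMat {a : Finset (Fin n)} (ha : a.Nonempty) : corMax (corRowMat a) = 1 := by
  apply le_antisymm
  · refine sup'_le _ _ fun x _ => ?_
    rw [corVal_corRowMat]
    have : 0 ≤ udisj n a x := sq_nonneg _
    linarith
  · obtain ⟨i, hi⟩ := ha
    have h1 : corVal (corRowMat a) {i} = 1 := by
      rw [corVal_corRowMat]
      unfold udisj
      rw [inter_singleton_of_mem hi, card_singleton]
      norm_num
    rw [← h1]
    exact le_sup' (corVal (corRowMat a)) (mem_univ _)

/-- **Block-diagonal SDP formulations of Boolean quadratic optimisation need a large block.** For `n ≥ 2`,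
`b ≥ 1`: every exact SDP formulation of `BQP_n` (Braun et al. Def. 2.2, any size `d`) whose solution matrices
`X^x` are block diagonal for a block assignment `blk : Fin d → Fin m` with blocks of size `≤ b` satisfies
`(3/2)^{n/(b+1)} ≤ m · 14400 b⁵ n⁶`; with `m ≤ n^k` blocks some block has dimension `Ω(n/((k+6) log n))`.
[cite: BraunEtAl2016, Def. 2.2, Lemma 2.3] [cite: GouveiaParriloThomas2013, Thm. 2.4] [cite: FawziParrilo2013, Thm. 1] -/
theorem corSDP_blockDiagonal {d m b : ℕ} (hn : 2 ≤ n) (hb : 1 ≤ b)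
    (E : SDPFormulation (corProblem n) d) (blk : Fin d → Fin m)
    (hX : ∀ (x : Finset (Fin n)) (p q : Fin d), blk p ≠ blk q → E.X x p q = 0)
    (hsize : ∀ i : Fin m, (univ.filter fun p : Fin d => blk p = i).card ≤ b) :
    (3 / 2 : ℝ) ^ ((n : ℝ) / (b + 1)) ≤ m * (14400 * (b : ℝ) ^ 5 * (n : ℝ) ^ 6) := by
  -- duality factorization of the rows `c_a`, `a ≠ ∅`
  choose U hU hslack using fun a : {a : Finset (Fin n) // a.Nonempty} =>
    E.exists_posSemidef_slack_of_attained (corProblem_sound (corRowMat a.1)) (corProblem_attained (corRowMat a.1))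
  have hS : ∀ (a : {a : Finset (Fin n) // a.Nonempty}) (x : Finset (Fin n)),
      udisj n a.1 x = (U a * E.X x).trace := by
    intro a x
    rw [← hslack a x]
    show udisj n a.1 x = corMax (corRowMat a.1) - corVal (corRowMat a.1) x
    rw [corMax_corRowMat a.2, corVal_corRowMat, sub_sub_cancel]
  -- block index types and their embeddings into `Fin b`
  have hcard : ∀ i : Fin m, Fintype.card {p : Fin d // blk p = i} ≤ b := by
    intro i
    rw [Fintype.card_subtype]
    exact hsize i
  let emb : (i : Fin m) → {p : Fin d // blk p = i} ↪ Fin b := fun i =>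
    (Fintype.equivFin {p : Fin d // blk p = i}).toEmbedding.trans (Fin.castLEEmb (hcard i))
  refine udisj_blockPsd_nonempty hn hb
    (fun a i => (1 : Matrix (Fin b) (Fin b) ℝ).submatrix id (emb i) *
        (U a).submatrix Subtype.val Subtype.val * ((1 : Matrix (Fin b) (Fin b) ℝ).submatrix id (emb i))ᴴ)
    (fun x i => (1 : Matrix (Fin b) (Fin b) ℝ).submatrix id (emb i) *
        (E.X x).submatrix Subtype.val Subtype.val * ((1 : Matrix (Fin b) (Fin b) ℝ).submatrix id (emb i))ᴴ)
    (fun a i => ((hU a).submatrix _).mul_mul_conjTranspose_same _)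
    (fun x i => ((E.posSemidef_X x).submatrix _).mul_mul_conjTranspose_same _) fun a x => ?_
  rw [hS a x, trace_mul_blockDiagonal_split blk (U a) (E.X x) (hX x)]
  refine sum_congr rfl fun i _ => ?_
  rw [trace_extend_mul_extend (emb i), trace_submatrix_mul_submatrix]

end Summit.PneNP.PneNP.Theorems.SupportRectangleBlockLift

end
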